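import Mathlib
import HarnessLib

/-!
# Uniform deviates: `−log U` is exponential, and `cos²(2πU)` integrates like a Cauchy variable

HONEST FRAMING: exact (Metropolis-corrected) sampling algorithms for lattice gauge theory;
figures of merit are autocorrelation/cost numbers at stated couplings and volumes; no
continuum-physics claim.

Venture `LatticeQCDFlow` (cell pub-lqcd), topic `Exactness`, FANOUT row 9 (eng-latcore, the
engine `latflow.core`).  NEW WORK of the cell over Mathlib; nothing here is cited as a fact.
Printed counterparts, NAMED ONLY: Kennedy–Pendleton, Phys. Lett. B 156 (1985) 393 (the SU(2)
heat-bath inner draw `λ² = −(ln R + cos²(2πR′) ln R″)/(2βk)`); Devroye 1986 Ch. II (inversion),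
Ch. IX.3 (gamma generators).

This is the first of the files typing the engine's `a₀` draw (`csrc/latcore_template.c`
`sample_a0`, `updates.py` `sample_a0_kp` / `sample_a0_creutz`) in idealised real arithmetic.
It supplies the two one-dimensional transfer identities every later step uses, stated for
ARBITRARY `ℝ≥0∞`-valued integrands (so that they can be used inside Tonelli iterated integrals
without measurability bookkeeping):

* `unitLaw` — the law of one call of the uniform generator: Lebesgue measure on `(0, 1)`
  (a probability measure);
* **`lintegral_neg_log_unitLaw`** — `∫ g(−log r) d unitLaw(r) = ∫_{(0,∞)} e^{−x} g(x) dx`: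
  minus the logarithm of a uniform deviate is a unit-rate exponential variable (inversion);
* `lintegral_exp_comp_mul` — scaling an exponential variable by `c > 0`:
  `∫_{(0,∞)} e^{−x} g(c x) dx = ∫_{(0,∞)} (e^{−y/c}/c) g(y) dy`;
* **`lintegral_cos_sq_two_pi_mul_unitLaw`** — for EVERY `h ≥ 0`,
  `∫ h(cos²(2πu)) d unitLaw(u) = ∫_ℝ h(1/(1+t²)) dt / (π(1+t²))`: the squared cosine of a
  uniform angle is `1/(1+T²)` for a standard Cauchy variable `T` (the substitution
  `t = tan(2πu)` on the three branches `(0,¼)`, `(¼,¾)`, `(¾,1)`);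
* **`lintegral_halfGamma_kernel_unitLaw`** — the consequence the Kennedy–Pendleton algorithm
  needs: for `y > 0`, `∫ e^{−y/cos²(2πu)} / cos²(2πu) d unitLaw(u) = e^{−y}/√(πy)`
  (the Cauchy form turns the angular integral into the Gaussian integral
  `∫_ℝ e^{−y t²} dt = √(π/y)`); this is the value that makes `cos²(2πU)·E` a Gamma(½) variable
  (`KennedyPendletonGamma.lean`).

Division by zero is Lean's `x / 0 = 0`; the two points `u ∈ {¼, ¾}` where `cos(2πu) = 0` are
Lebesgue-null and never matter.
-/

namespace Summit.Ventures.LatticeQCDFlow.Exactness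

open MeasureTheory Measure Set
open scoped ENNReal

/-! ## §1 The uniform law on `(0, 1)` -/

/-- The law of one call of the engine's uniform generator, idealised: Lebesgue measure on the open
unit interval. -/
noncomputable def unitLaw : Measure ℝ := volume.restrict (Ioo (0 : ℝ) 1)

/-- `unitLaw` is a probability measure. -/
instance isProbabilityMeasure_unitLaw : IsProbabilityMeasure unitLaw :=
  ⟨by rw [unitLaw, Measure.restrict_apply_univ, Real.volume_Ioo]; simp⟩

/-- `unitLaw` is carried by `(0, 1)`. -/
theorem unitLaw_apply {s : Set ℝ} (hs : MeasurableSet s) : unitLaw s = volume (s ∩ Ioo 0 1) := by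
  rw [unitLaw, Measure.restrict_apply hs]

/-- Integrating against `unitLaw` is integrating over `(0, 1)`. -/
theorem lintegral_unitLaw (g : ℝ → ℝ≥0∞) : ∫⁻ r, g r ∂unitLaw = ∫⁻ r in Ioo 0 1, g r := rfl

/-! ## §2 `−log` of a uniform deviate is a unit exponential -/

/-- `x ↦ e^{−x}` maps `(0, ∞)` onto `(0, 1)`. -/
theorem image_exp_neg_Ioi : (fun x : ℝ => Real.exp (-x)) '' Ioi 0 = Ioo 0 1 := by
  ext r
  constructor
  · rintro ⟨x, hx, rfl⟩
    exact ⟨Real.exp_pos _, Real.exp_lt_one_iff.mpr (neg_lt_zero.mpr hx)⟩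
  · rintro ⟨h0, h1⟩
    refine ⟨-Real.log r, neg_pos.mpr (Real.log_neg h0 h1), ?_⟩
    simp only [neg_neg]
    exact Real.exp_log h0

/-- **Inversion: `−log` of a uniform deviate is exponential.**  For every `g ≥ 0`,
`∫ g(−log r) d unitLaw(r) = ∫_{(0,∞)} e^{−x} g(x) dx`. -/
theorem lintegral_neg_log_unitLaw (g : ℝ → ℝ≥0∞) :
    ∫⁻ r, g (-Real.log r) ∂unitLaw = ∫⁻ x in Ioi 0, ENNReal.ofReal (Real.exp (-x)) * g x := by
  have hderiv : ∀ x ∈ Ioi (0 : ℝ),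
      HasDerivWithinAt (fun x : ℝ => Real.exp (-x)) (Real.exp (-x) * -1) (Ioi 0) x :=
    fun x _ => ((Real.hasDerivAt_exp (-x)).comp x (hasDerivAt_neg x)).hasDerivWithinAt
  have hinj : InjOn (fun x : ℝ => Real.exp (-x)) (Ioi 0) :=
    (Real.exp_injective.comp neg_injective).injOn
  rw [lintegral_unitLaw, ← image_exp_neg_Ioi,
    lintegral_image_eq_lintegral_abs_deriv_mul measurableSet_Ioi hderiv hinj]
  refine setLIntegral_congr_fun measurableSet_Ioi fun x _ => ?_
  simp only [mul_neg_one, abs_neg, abs_of_pos (Real.exp_pos _), Real.log_exp, neg_neg]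

/-- `x ↦ c x` maps `(0, ∞)` onto itself for `c > 0`. -/
theorem image_const_mul_Ioi {c : ℝ} (hc : 0 < c) : (fun x : ℝ => c * x) '' Ioi 0 = Ioi 0 := by
  ext y
  constructor
  · rintro ⟨x, hx, rfl⟩
    exact mul_pos hc hx
  · intro hy
    exact ⟨y / c, div_pos hy hc, mul_div_cancel₀ _ hc.ne'⟩

/-- **Scaling an exponential variable.**  For `c > 0` and every `g ≥ 0`,
`∫_{(0,∞)} e^{−x} g(c x) dx = ∫_{(0,∞)} (e^{−y/c}/c) g(y) dy`. -/
theorem lintegral_exp_comp_mul {c : ℝ} (hc : 0 < c) (g : ℝ → ℝ≥0∞) :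
    ∫⁻ x in Ioi 0, ENNReal.ofReal (Real.exp (-x)) * g (c * x) =
      ∫⁻ y in Ioi 0, ENNReal.ofReal (Real.exp (-(y / c)) / c) * g y := by
  have hderiv : ∀ x ∈ Ioi (0 : ℝ), HasDerivWithinAt (fun x : ℝ => c * x) c (Ioi 0) x := by
    intro x _
    simpa using ((hasDerivAt_id x).const_mul c).hasDerivWithinAt
  have hinj : InjOn (fun x : ℝ => c * x) (Ioi 0) := (mul_right_injective₀ hc.ne').injOn
  conv_rhs => rw [← image_const_mul_Ioi hc]
  rw [lintegral_image_eq_lintegral_abs_deriv_mul measurableSet_Ioi hderiv hinj]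
  refine setLIntegral_congr_fun measurableSet_Ioi fun x _ => ?_
  rw [abs_of_pos hc, mul_div_cancel_left₀ _ hc.ne', ← mul_assoc, ← ENNReal.ofReal_mul hc.le,
    ← mul_div_assoc, mul_div_cancel_left₀ _ hc.ne']

/-! ## §3 The squared cosine of a uniform angle: the Cauchy substitution `t = tan θ` -/

section Angle

open Real

/-- Branch `k` of the substitution: `t ↦ (arctan t + kπ)/(2π)`. -/
noncomputable def arctanBranch (k : ℝ) (t : ℝ) : ℝ := (arctan t + k * π) / (2 * π)

/-- Derivative of a branch: `1 / (2π(1+t²))`. -/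
theorem hasDerivAt_arctanBranch (k t : ℝ) :
    HasDerivAt (arctanBranch k) (1 / (1 + t ^ 2) / (2 * π)) t := by
  unfold arctanBranch
  exact ((hasDerivAt_arctan t).add_const (k * π)).div_const (2 * π)

/-- Each branch is injective. -/
theorem injective_arctanBranch (k : ℝ) : Function.Injective (arctanBranch k) := by
  intro s t h
  unfold arctanBranch at h
  have hπ : (2 * π) ≠ 0 := by positivity
  have := (div_left_inj' hπ).mp h
  exact arctan_strictMono.injective (add_right_cancel this)

/-- On branch `k ∈ ℕ` the squared cosine of the angle is `1/(1+t²)`. -/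
theorem cos_sq_two_pi_mul_arctanBranch (k : ℕ) (t : ℝ) :
    cos (2 * π * arctanBranch k t) ^ 2 = 1 / (1 + t ^ 2) := by
  unfold arctanBranch
  have hπ : (2 * π) ≠ 0 := by positivity
  rw [mul_div_cancel₀ _ hπ, ← cos_sq_arctan t]
  rw [show arctan t + (k : ℝ) * π = arctan t + (k : ℕ) * π from rfl, cos_add_nat_mul_pi]
  rw [mul_pow, ← pow_mul, pow_mul', neg_one_sq, one_pow, one_mul]

/-- Branch `0` maps `(0, ∞)` onto `(0, ¼)`. -/
theorem image_arctanBranch_zero : arctanBranch 0 '' Ioi 0 = Ioo 0 (1 / 4) := by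
  have hπ : 0 < 2 * π := by positivity
  ext u
  simp only [arctanBranch, zero_mul, add_zero, mem_image, mem_Ioi, mem_Ioo]
  constructor
  · rintro ⟨t, ht, rfl⟩
    refine ⟨div_pos (arctan_pos.mpr ht) hπ, ?_⟩
    rw [div_lt_iff₀ hπ]
    linarith [arctan_lt_pi_div_two t]
  · rintro ⟨h0, h1⟩
    refine ⟨tan (2 * π * u), tan_pos_of_pos_of_lt_pi_div_two (by positivity) (by nlinarith [pi_pos]), ?_⟩
    rw [arctan_tan (by nlinarith [pi_pos]) (by nlinarith [pi_pos])]
    field_simp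

/-- Branch `1` maps `ℝ` onto `(¼, ¾)`. -/
theorem image_arctanBranch_one : arctanBranch 1 '' univ = Ioo (1 / 4) (3 / 4) := by
  have hπ : 0 < 2 * π := by positivity
  ext u
  simp only [arctanBranch, one_mul, image_univ, mem_range, mem_Ioo]
  constructor
  · rintro ⟨t, rfl⟩
    constructor
    · rw [lt_div_iff₀ hπ]; linarith [neg_pi_div_two_lt_arctan t]
    · rw [div_lt_iff₀ hπ]; linarith [arctan_lt_pi_div_two t]
  · rintro ⟨h0, h1⟩
    refine ⟨tan (2 * π * u - π), ?_⟩
    rw [arctan_tan (by nlinarith [pi_pos]) (by nlinarith [pi_pos])]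
    field_simp
    ring

/-- Branch `2` maps `(−∞, 0)` onto `(¾, 1)`. -/
theorem image_arctanBranch_two : arctanBranch 2 '' Iio 0 = Ioo (3 / 4) 1 := by
  have hπ : 0 < 2 * π := by positivity
  ext u
  simp only [arctanBranch, mem_image, mem_Iio, mem_Ioo]
  constructor
  · rintro ⟨t, ht, rfl⟩
    constructor
    · rw [lt_div_iff₀ hπ]; linarith [neg_pi_div_two_lt_arctan t]
    · rw [div_lt_iff₀ hπ]; linarith [arctan_lt_zero.mpr ht]
  · rintro ⟨h0, h1⟩
    refine ⟨tan (2 * π * u - 2 * π), tan_neg_of_neg_of_pi_div_two_lt (by nlinarith [pi_pos])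
      (by nlinarith [pi_pos]), ?_⟩
    rw [arctan_tan (by nlinarith [pi_pos]) (by nlinarith [pi_pos])]
    field_simp
    ring

/-- The substitution on one branch: `∫_{branch k '' s} h(cos²(2πu)) du = ∫_s h(1/(1+t²)) dt/(2π(1+t²))`. -/
theorem lintegral_image_arctanBranch (k : ℕ) {s : Set ℝ} (hs : MeasurableSet s) (h : ℝ → ℝ≥0∞) :
    ∫⁻ u in arctanBranch k '' s, h (cos (2 * π * u) ^ 2) =
      ∫⁻ t in s, ENNReal.ofReal (1 / (1 + t ^ 2) / (2 * π)) * h (1 / (1 + t ^ 2)) := by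
  rw [lintegral_image_eq_lintegral_abs_deriv_mul hs
    (fun t _ => (hasDerivAt_arctanBranch (k : ℝ) t).hasDerivWithinAt)
    (injective_arctanBranch (k : ℝ)).injOn]
  refine setLIntegral_congr_fun hs fun t _ => ?_
  rw [abs_of_nonneg (by positivity), cos_sq_two_pi_mul_arctanBranch]

/-- The unit interval is, up to the two null points `¼, ¾`, the disjoint union of the three
branch images. -/
theorem Ioo_zero_one_ae_eq_branches :
    (Ioo 0 (1 / 4) ∪ (Ioo (1 / 4) (3 / 4) ∪ Ioo (3 / 4) 1) : Set ℝ) =ᵐ[volume] Ioo 0 1 := by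
  refine ae_eq_set.mpr ⟨?_, ?_⟩
  · rw [Set.sdiff_eq_empty.mpr, measure_empty]
    rintro u (hu | hu | hu) <;> constructor <;> linarith [hu.1, hu.2]
  · refine measure_mono_null (t := {1 / 4, 3 / 4}) ?_ ((Set.toFinite _).measure_zero _)
    intro u ⟨⟨h0, h1⟩, hn⟩
    simp only [mem_union, mem_Ioo, not_or, not_and, not_lt] at hn
    simp only [mem_insert_iff, mem_singleton_iff]
    rcases lt_trichotomy u (1 / 4) with h | h | h
    · exact absurd (hn.1 h0) (not_le.mpr h)
    · exact Or.inl h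
    · rcases lt_trichotomy u (3 / 4) with h' | h' | h'
      · exact absurd (hn.2.1 h) (not_le.mpr h')
      · exact Or.inr h'
      · exact absurd (hn.2.2 h') (not_le.mpr h1)

/-- Splitting an integral over `ℝ` at the null point `0`. -/
theorem lintegral_Ioi_add_Iio (G : ℝ → ℝ≥0∞) :
    (∫⁻ t in Ioi 0, G t) + ∫⁻ t in Iio 0, G t = ∫⁻ t, G t := by
  have h := lintegral_add_compl G (measurableSet_Ioi (a := (0 : ℝ))) (μ := volume)
  rw [compl_Ioi] at h
  rw [← h, setLIntegral_congr (Iio_ae_eq_Iic (μ := (volume : Measure ℝ)) (a := (0 : ℝ)))]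

/-- **The squared cosine of a uniform angle integrates like `1/(1+T²)`, `T` standard Cauchy.**
For EVERY `h ≥ 0`, `∫ h(cos²(2πu)) d unitLaw(u) = ∫_ℝ h(1/(1+t²)) dt / (π(1+t²))`. -/
theorem lintegral_cos_sq_two_pi_mul_unitLaw (h : ℝ → ℝ≥0∞) :
    ∫⁻ u, h (cos (2 * π * u) ^ 2) ∂unitLaw =
      ∫⁻ t, ENNReal.ofReal (1 / (π * (1 + t ^ 2))) * h (1 / (1 + t ^ 2)) := by
  have h0 := lintegral_image_arctanBranch 0 (measurableSet_Ioi (a := (0 : ℝ))) h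
  have h1 := lintegral_image_arctanBranch 1 (MeasurableSet.univ (α := ℝ)) h
  have h2 := lintegral_image_arctanBranch 2 (measurableSet_Iio (a := (0 : ℝ))) h
  simp only [Nat.cast_zero, Nat.cast_one, Nat.cast_ofNat, Measure.restrict_univ] at h0 h1 h2
  rw [lintegral_unitLaw, ← setLIntegral_congr Ioo_zero_one_ae_eq_branches,
    lintegral_union (measurableSet_Ioo.union measurableSet_Ioo), lintegral_union measurableSet_Ioo]
  rotate_left
  · exact disjoint_left.mpr fun u hu hu' => by linarith [hu.2, hu'.1]
  · refine Disjoint.union_right ?_ ?_ <;>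
      exact disjoint_left.mpr fun u hu hu' => by linarith [hu.2, hu'.1]
  rw [← image_arctanBranch_zero, ← image_arctanBranch_one, ← image_arctanBranch_two, h0, h1, h2]
  -- `∫_{t>0} F + (∫ F + ∫_{t<0} F) = 2 ∫ F`
  rw [add_left_comm,
    lintegral_Ioi_add_Iio (fun t => ENNReal.ofReal (1 / (1 + t ^ 2) / (2 * π)) * h (1 / (1 + t ^ 2))),
    ← two_mul, ← lintegral_const_mul' _ _ ENNReal.ofNat_ne_top]
  refine lintegral_congr fun t => ?_
  rw [← mul_assoc]
  congr 1
  rw [show (2 : ℝ≥0∞) = ENNReal.ofReal 2 by simp, ← ENNReal.ofReal_mul zero_le_two]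
  congr 1
  field_simp

/-- **The Gamma(½) kernel.**  For `y > 0`,
`∫ e^{−y/cos²(2πu)} / cos²(2πu) d unitLaw(u) = e^{−y}/√(πy)`: after the Cauchy substitution
the angular integral is the Gaussian integral `∫_ℝ e^{−y t²} dt = √(π/y)`. -/
theorem lintegral_halfGamma_kernel_unitLaw {y : ℝ} (hy : 0 < y) :
    ∫⁻ u, ENNReal.ofReal (Real.exp (-(y / cos (2 * π * u) ^ 2)) / cos (2 * π * u) ^ 2) ∂unitLaw =
      ENNReal.ofReal (Real.exp (-y) / Real.sqrt (π * y)) := by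
  rw [lintegral_cos_sq_two_pi_mul_unitLaw (fun v => ENNReal.ofReal (Real.exp (-(y / v)) / v))]
  have hpt : ∀ t : ℝ, ENNReal.ofReal (1 / (π * (1 + t ^ 2))) *
      ENNReal.ofReal (Real.exp (-(y / (1 / (1 + t ^ 2)))) / (1 / (1 + t ^ 2))) =
      ENNReal.ofReal (Real.exp (-y) / π * Real.exp (-y * t ^ 2)) := by
    intro t
    have ht : (0 : ℝ) < 1 + t ^ 2 := by positivity
    rw [← ENNReal.ofReal_mul (by positivity)]
    congr 1
    rw [show -(y / (1 / (1 + t ^ 2))) = -y + -y * t ^ 2 by field_simp; ring, Real.exp_add]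
    field_simp
  simp_rw [hpt]
  have hint : Integrable fun t : ℝ => Real.exp (-y) / π * Real.exp (-y * t ^ 2) :=
    (integrable_exp_neg_mul_sq hy).const_mul _
  rw [← ofReal_integral_eq_lintegral_ofReal hint (ae_of_all _ fun t => by positivity),
    integral_const_mul, integral_gaussian y]
  congr 1
  have hsπ : 0 < Real.sqrt π := Real.sqrt_pos.mpr pi_pos
  have hsy : 0 < Real.sqrt y := Real.sqrt_pos.mpr hy
  rw [Real.sqrt_div pi_pos.le, Real.sqrt_mul pi_pos.le, div_mul_div_comm,
    div_eq_div_iff (by positivity) (by positivity)]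
  linear_combination (Real.exp (-y) * Real.sqrt y) * Real.mul_self_sqrt pi_pos.le

end Angle

end Summit.Ventures.LatticeQCDFlow.Exactness
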